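import Summits.CriticalPhenomena.PercolationContinuityZ3.Theorems.PercNearOneGluingNoHeavyQuantFarSunCfgSym
import HarnessLib

/-!
# FAR beyond trees: `HairyCycle.SunFAR K j` from a CONFIGURATION-LEVEL two-copy certificate (the ghost sees its whole
# configuration — open-hair set and arc extents — not only its reached set) — part 2 of 2: the certificate and the final step

builds on p205010 (kernel theorem, internal audit signed; external expert review pending)

Support file (`--supports stmt-CriticalPhenomena-4575`), seat `prim-cert-1` (gen 26); memo `prim-cert-1/FROM-prim-cert-1-g26-*.md`.
See `…QuantFarSunCfgSym` (part 1: `TK.tcEc`, `TK.tcE2c`, `TK.tcE2c_nonneg_of_core`).  Here: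
* `TK.Fcfg`, `TK.Wcfg` — the layer-`j` configuration-level pair function of a certificate `a_k(Q',m,m')`, `b(Q',m,m')` (copy 1 pays through its
  reached set `Q ∩ cov K l l'`, the ghost copy 2 chooses the bets from its whole configuration) and its symmetrisation;
* **`TK.sunFAR_of_cfgCert`** — if `a, b ≥ 0`, every ghost configuration with at most `j` reached hairs bets (`Σ_k a_k ≥ 1`), and `Wcfg = Fcfg + Fcfgᵀ`
  satisfies the configuration-level CORE INEQUALITY (for `m ≤ l ≤ K+1`, `u ≤ v ≤ K`, disjoint `Z, T ⊆ range K`: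
  `0 ≤ Σ_{J⊆T} W (Z∪J) l u (Z∪T∖J) m v + Σ_{J⊆T} W (Z∪J) l v (Z∪T∖J) m u`), then `SunFAR K j` (`K ≥ 2`).
Every reached-set-level certificate (`TK.sunFAR_of_layerCert`) is the special case `a_k(Q',m,m') = a_k(Q' ∩ cov K m m')`; the point of the larger
class is that `K`-uniform typed certificates exist in it at layer 2 (gen 26 memo), while they provably do not at reached-set level.
No sorries; standard axioms.  Elementary [this work].
-/

noncomputable section

namespace Summit.CriticalPhenomena.PercolationContinuityZ3.Theorems.HairyCycle

namespace TK

open Finset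

variable {K : ℕ}

/-! ## The configuration-level certificate and the final step -/

/-- The layer-`j` CONFIGURATION-LEVEL pair function of a certificate `(a, b)`: copy 1 (configuration `(Q, l, l')`, reached set
`R = Q ∩ cov K l l'`) pays, copy 2 (the ghost, configuration `(Q', m, m')`) chooses the bets:
`F = Σ_{k<K} a_k(Q',m,m')·(𝟙[k ∉ R] − 𝟙[|R| ≤ j]) − b(Q',m,m')·(|R| − 2j)`. [this work] -/
def Fcfg (K j : ℕ) (a : ℕ → Finset ℕ → ℕ → ℕ → ℤ) (b : Finset ℕ → ℕ → ℕ → ℤ) (Q : Finset ℕ) (l l' : ℕ) (Q' : Finset ℕ) (m m' : ℕ) : ℤ :=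
  (∑ k ∈ range K, a k Q' m m' * ((if k ∉ Q ∩ cov K l l' then 1 else 0) - (if (Q ∩ cov K l l').card ≤ j then 1 else 0))) -
    b Q' m m' * (((Q ∩ cov K l l').card : ℤ) - 2 * j)

/-- The symmetrised configuration-level pair weight `W = F + Fᵀ`. [this work] -/
def Wcfg (K j : ℕ) (a : ℕ → Finset ℕ → ℕ → ℕ → ℤ) (b : Finset ℕ → ℕ → ℕ → ℤ) (Q : Finset ℕ) (l l' : ℕ) (Q' : Finset ℕ) (m m' : ℕ) : ℤ :=
  Fcfg K j a b Q l l' Q' m m' + Fcfg K j a b Q' m m' Q l l'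

/-- `Wcfg` is symmetric. [this work] -/
theorem Wcfg_comm (K j : ℕ) (a : ℕ → Finset ℕ → ℕ → ℕ → ℤ) (b : Finset ℕ → ℕ → ℕ → ℤ) (Q : Finset ℕ) (l l' : ℕ) (Q' : Finset ℕ) (m m' : ℕ) :
    Wcfg K j a b Q l l' Q' m m' = Wcfg K j a b Q' m m' Q l l' := by
  unfold Wcfg; ring

section Final

open scoped Classical

/-- `2 · E⊗E F = E⊗E W`. [this work] -/
theorem two_mul_tcE2c_Fcfg (j : ℕ) (a : ℕ → Finset ℕ → ℕ → ℕ → ℤ) (b : Finset ℕ → ℕ → ℕ → ℤ) (g h : ℕ → ℝ) :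
    2 * tcE2c K g h (fun Q l l' Q' m m' => (Fcfg K j a b Q l l' Q' m m' : ℝ)) =
      tcE2c K g h (fun Q l l' Q' m m' => (Wcfg K j a b Q l l' Q' m m' : ℝ)) := by
  have hsw := tcE2c_swap (K := K) g h (fun Q l l' Q' m m' => (Fcfg K j a b Q l l' Q' m m' : ℝ))
  have hlin := tcE2c_lin (K := K) g h 1 1 (fun Q l l' Q' m m' => (Fcfg K j a b Q l l' Q' m m' : ℝ))
    (fun Q l l' Q' m m' => (Fcfg K j a b Q' m m' Q l l' : ℝ))
  have hWdef : tcE2c K g h (fun Q l l' Q' m m' => (Wcfg K j a b Q l l' Q' m m' : ℝ)) =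
      tcE2c K g h (fun Q l l' Q' m m' => 1 * (Fcfg K j a b Q l l' Q' m m' : ℝ) + 1 * (Fcfg K j a b Q' m m' Q l l' : ℝ)) := by
    congr 1; ext Q l l' Q' m m'; unfold Wcfg; push_cast; ring
  rw [hWdef, hlin, hsw]
  ring

/-- **`SunFAR K j` from a configuration-level layer-`j` two-copy certificate** (`K ≥ 2`).  Hypotheses: `a_k(Q',m,m') ≥ 0` and
`b(Q',m,m') ≥ 0` for `Q' ⊆ range K`, `m ≤ K+1`, `m' ≤ K`; the normalisation `Σ_{k<K} a_k(Q',m,m') ≥ 1` whenever the ghost reaches at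
most `j` hairs (`|Q' ∩ cov K m m'| ≤ j`); and the configuration-level CORE INEQUALITY for `W = F + Fᵀ`.  Conclusion: FAR at layer `j` on the
sun graph with `K` hairs, all weights. [this work] -/
theorem sunFAR_of_cfgCert {j : ℕ} (hK : 2 ≤ K) {a : ℕ → Finset ℕ → ℕ → ℕ → ℤ} {b : Finset ℕ → ℕ → ℕ → ℤ}
    (ha : ∀ k, ∀ Q', Q' ⊆ range K → ∀ m, m ≤ K + 1 → ∀ m', m' ≤ K → 0 ≤ a k Q' m m')
    (hb : ∀ Q', Q' ⊆ range K → ∀ m, m ≤ K + 1 → ∀ m', m' ≤ K → 0 ≤ b Q' m m')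
    (hnorm : ∀ Q', Q' ⊆ range K → ∀ m, m ≤ K + 1 → ∀ m', m' ≤ K → (Q' ∩ cov K m m').card ≤ j → (1 : ℤ) ≤ ∑ k ∈ range K, a k Q' m m')
    (hcore : ∀ l m u v : ℕ, m ≤ l → l ≤ K + 1 → u ≤ v → v ≤ K →
      ∀ Z T : Finset ℕ, Z ⊆ range K → T ⊆ range K → Disjoint Z T →
        0 ≤ (∑ J ∈ T.powerset, Wcfg K j a b (Z ∪ J) l u (Z ∪ (T \ J)) m v) + ∑ J ∈ T.powerset, Wcfg K j a b (Z ∪ J) l v (Z ∪ (T \ J)) m u) :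
    SunFAR K j := by
  intro g h hg hh hEN t ht
  set P1 : ℝ := sunLaw K g h (fun R => R.card ≤ j) with hP1
  have eP1 : P1 = tcE K g h (fun R => if R.card ≤ j then 1 else 0) := by
    rw [hP1, sunLaw_eq_tcE]; exact tcE_congr fun R _ => by congr
  have eq_k : ∀ k, k < K → tcE K g h (fun R => if k ∉ R then (1 : ℝ) else 0) = 1 - sunMarg K g h k := by
    intro k hk
    rw [← sunLaw_mem_eq_sunMarg hK hg hh hk, ← sunLaw_not hK hg hh, sunLaw_eq_tcE]
    exact tcE_congr fun R _ => by congr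
  have eEN : tcE K g h (fun R => (R.card : ℝ)) = ∑ k ∈ range K, sunMarg K g h k := by
    have e1 : tcE K g h (fun R => (R.card : ℝ)) = tcE K g h (fun R => ∑ k ∈ range K, if k ∈ R then (1 : ℝ) else 0) := by
      refine tcE_congr fun R hR => ?_
      rw [Finset.sum_ite_mem, Finset.inter_eq_right.2 hR, Finset.sum_const, nsmul_eq_mul, mul_one]
    rw [e1, tcE_sum]
    refine Finset.sum_congr rfl fun k hk => ?_
    rw [Finset.mem_range] at hk
    rw [← sunLaw_mem_eq_sunMarg hK hg hh hk, sunLaw_eq_tcE]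
    exact tcE_congr fun R _ => by congr
  -- the certificate identity
  set abar : ℕ → ℝ := fun k => tcEc K g h (fun Q' m m' => (a k Q' m m' : ℝ)) with habar
  set bbar : ℝ := tcEc K g h (fun Q' m m' => (b Q' m m' : ℝ)) with hbbar
  have hF : tcE2c K g h (fun Q l l' Q' m m' => (Fcfg K j a b Q l l' Q' m m' : ℝ)) =
      ∑ k ∈ range K, (tcE K g h (fun R => if k ∉ R then (1 : ℝ) else 0) - P1) * abar k -
        (tcE K g h (fun R => (R.card : ℝ)) - 2 * j) * bbar := by
    have epoint : (fun Q l l' Q' m m' => (Fcfg K j a b Q l l' Q' m m' : ℝ)) = fun Q l l' Q' m m' =>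
        1 * (∑ k ∈ range K, (a k Q' m m' : ℝ) *
          ((if k ∉ Q ∩ cov K l l' then (1 : ℝ) else 0) - (if (Q ∩ cov K l l').card ≤ j then (1 : ℝ) else 0))) +
          (-1) * ((b Q' m m' : ℝ) * (((Q ∩ cov K l l').card : ℝ) - 2 * j)) := by
      ext Q l l' Q' m m'; unfold Fcfg; push_cast; ring
    have eA : ∀ k, tcE2c K g h (fun Q l l' Q' m m' => (a k Q' m m' : ℝ) *
        ((if k ∉ Q ∩ cov K l l' then (1 : ℝ) else 0) - (if (Q ∩ cov K l l').card ≤ j then (1 : ℝ) else 0))) =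
        (tcE K g h (fun R => if k ∉ R then (1 : ℝ) else 0) - P1) * abar k := by
      intro k
      have hp := tcE2c_prod (K := K) g h (fun R => 1 * (if k ∉ R then (1 : ℝ) else 0) + (-1) * (if R.card ≤ j then (1 : ℝ) else 0))
        (fun Q' m m' => (a k Q' m m' : ℝ))
      have e1 : (fun Q l l' Q' m m' => (a k Q' m m' : ℝ) *
          ((if k ∉ Q ∩ cov K l l' then (1 : ℝ) else 0) - (if (Q ∩ cov K l l').card ≤ j then (1 : ℝ) else 0))) =
          fun Q l l' Q' m m' => (fun R => 1 * (if k ∉ R then (1 : ℝ) else 0) + (-1) * (if R.card ≤ j then (1 : ℝ) else 0))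
            (Q ∩ cov K l l') * (fun Q' m m' => (a k Q' m m' : ℝ)) Q' m m' := by
        ext Q l l' Q' m m'; ring
      rw [e1, hp, tcE_lin, ← eP1]; ring
    have eB : tcE2c K g h (fun Q l l' Q' m m' => (b Q' m m' : ℝ) * (((Q ∩ cov K l l').card : ℝ) - 2 * j)) =
        (tcE K g h (fun R => (R.card : ℝ)) - 2 * j) * bbar := by
      have hp := tcE2c_prod (K := K) g h (fun R => 1 * (R.card : ℝ) + (-(2 * j : ℝ)) * (1 : ℝ)) (fun Q' m m' => (b Q' m m' : ℝ))
      have e1 : (fun Q l l' Q' m m' => (b Q' m m' : ℝ) * (((Q ∩ cov K l l').card : ℝ) - 2 * j)) =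
          fun Q l l' Q' m m' => (fun R => 1 * (R.card : ℝ) + (-(2 * j : ℝ)) * (1 : ℝ)) (Q ∩ cov K l l') *
            (fun Q' m m' => (b Q' m m' : ℝ)) Q' m m' := by
        ext Q l l' Q' m m'; ring
      rw [e1, hp, tcE_lin, tcE_const]; ring
    rw [epoint, tcE2c_lin, tcE2c_sum, eB]
    simp only [eA]
    ring
  -- signs
  have habar0 : ∀ k, 0 ≤ abar k := fun k => tcEc_nonneg hg hh fun Q' hQ' m hm m' hm' => by exact_mod_cast ha k Q' hQ' m hm m' hm'
  have hbbar0 : 0 ≤ bbar := tcEc_nonneg hg hh fun Q' hQ' m hm m' hm' => by exact_mod_cast hb Q' hQ' m hm m' hm'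
  have hq : ∀ k ∈ range K, tcE K g h (fun R => if k ∉ R then (1 : ℝ) else 0) ≤ t := by
    intro k hk; rw [Finset.mem_range] at hk; rw [eq_k k hk]; exact ht k hk
  -- main inequality: Σ_k (q_k − P1)·ā_k ≥ (EN − 2j)·b̄ ≥ 0
  have hmain : 0 ≤ ∑ k ∈ range K, (tcE K g h (fun R => if k ∉ R then (1 : ℝ) else 0) - P1) * abar k := by
    have h1 : 0 ≤ tcE2c K g h (fun Q l l' Q' m m' => (Fcfg K j a b Q l l' Q' m m' : ℝ)) := by
      have hW := tcE2c_nonneg_of_core hcore (Wcfg_comm K j a b) hg hh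
      have h2 := two_mul_tcE2c_Fcfg (K := K) j a b g h
      linarith
    rw [hF, eEN] at h1
    have h2 : 0 ≤ (∑ k ∈ range K, sunMarg K g h k - 2 * j) * bbar := mul_nonneg (by linarith) hbbar0
    linarith
  have hsum : 0 ≤ ∑ k ∈ range K, (t - P1) * abar k := by
    refine le_trans hmain (Finset.sum_le_sum fun k hk => ?_)
    exact mul_le_mul_of_nonneg_right (by linarith [hq k hk]) (habar0 k)
  rw [← Finset.mul_sum] at hsum
  -- `Σ_k ā_k ≥ P1` (every ghost configuration with at most `j` reached hairs bets)
  have hge : P1 ≤ ∑ k ∈ range K, abar k := by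
    have e : ∑ k ∈ range K, abar k = tcEc K g h (fun Q' m m' => ∑ k ∈ range K, (a k Q' m m' : ℝ)) := by rw [tcEc_sum]
    rw [e, eP1, tcE_eq_tcEc]
    refine tcEc_mono hg hh fun Q' hQ' m hm m' hm' => ?_
    show (if (Q' ∩ cov K m m').card ≤ j then (1 : ℝ) else 0) ≤ ∑ k ∈ range K, (a k Q' m m' : ℝ)
    split_ifs with hc
    · exact_mod_cast hnorm Q' hQ' m hm m' hm' hc
    · exact Finset.sum_nonneg fun k _ => by exact_mod_cast ha k Q' hQ' m hm m' hm'
  -- `t ≥ 0`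
  have ht0 : 0 ≤ t := by
    have h0 : 0 < K := by omega
    have := ht 0 h0
    have hm : sunMarg K g h 0 ≤ 1 := by rw [← sunLaw_mem_eq_sunMarg hK hg hh h0]; exact sunLaw_le_one hK hg hh _
    linarith
  refine le_of_not_gt fun hcon => ?_
  have hP1pos : 0 < P1 := lt_of_le_of_lt ht0 hcon
  have hpos : 0 < ∑ k ∈ range K, abar k := lt_of_lt_of_le hP1pos hge
  have : (t - P1) * ∑ k ∈ range K, abar k < 0 := mul_neg_of_neg_of_pos (by linarith) hpos
  linarith

end Final

end TK

end Summit.CriticalPhenomena.PercolationContinuityZ3.Theorems.HairyCycle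

end
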